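import Literature.NumberTheory.GaloisRepresentations.CliffordConstituentGeometric
import HarnessLib

/-!
# The unit of Frobenius reciprocity in coordinates: `ρ(σ₁) ρ ρ(σ₁)⁻¹ ↪ (Ind_{Γ_F}^{Γ_K} ρ)|_{Γ_F}`
(support item stmt-Langlands-31696 `WeilRestrictionSplit.WeilRestrictionConstituent`, helper file 4)

For an ARBITRARY finite extension of number fields `F/K` of degree `d` and a framed
`ρ : Γ_F →ₜ* GL_n(A)`, the induced representation `Ind(ρ) = (ρ̇(rᵢ⁻¹ g rⱼ))ᵢⱼ`
(`FramedGaloisRep.induce`) restricted to `Γ_F` receives `ρ`, up to the change of frame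
`ρ(σ₁) ρ ρ(σ₁)⁻¹` with `res σ₁ = r_{i₀}⁻¹` for the trivial coset `i₀`, as the sub-representation on
the block of coordinates of index `i₀`: there is an injective linear `f : Aⁿ → A^{dn}` (the vector
`(x, 0)` in a relabelling putting block `i₀` first) with `Ind(ρ)(res σ)·f(x) = f((ρ(σ₁) ρ(σ) ρ(σ₁)⁻¹)·x)`
(`exists_embedding_induce_restrictField`).  This is Mackey's formula at the trivial double coset,
WITHOUT normality of `res(Γ_F)`: the block column `i₀` of `Ind(ρ)(res σ)` vanishes off the diagonal
and the diagonal block is `ρ(σ₁ σ σ₁⁻¹)` — the computation of the tree's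
`Literature.NumberTheory.GaloisRepresentations.exists_induce_restrictField_eq_reindex_fromBlocks`
(`Literature/NumberTheory/PAdicHodge/DeRhamInducedRepresentationProofs.lean`, whose module is not
importable from here at present), re-run to the point needed and concluded on vectors
(`reindex_fromBlocks_mulVec_inl`).  No definitions, no named facts.

References: J.-P. Serre, *Linear representations of finite groups* (1977), §3.3 Thm. 12, §7.2,
§7.3 Prop. 22; J.-P. Serre, *Abelian ℓ-adic representations and elliptic curves* (1968), Ch. I §2.1.
-/

noncomputable section

set_option linter.dupNamespace false -- project-wide option (lakefile weak.linter.dupNamespace); `Summit.Langlands.Langlands` is the mandated namespace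

open scoped MatrixGroups
open Matrix Field
open Literature.NumberTheory.GaloisRepresentations

namespace Summit.Langlands.Langlands.Theorems.WeilRestrictionConstituentProof

/-- The vector `(x, 0)` relabelled along `e : Fin m ⊕ Fin q ≃ Fin n`, as an injective linear map
`kᵐ → kⁿ` (the inclusion of the first block of coordinates); stated as an existence so that no
definition is introduced. [folklore] -/
theorem exists_blockInl {k : Type*} [CommRing k] {m q n : ℕ} (e : Fin m ⊕ Fin q ≃ Fin n) :
    ∃ f : (Fin m → k) →ₗ[k] (Fin n → k), Function.Injective f ∧
      ∀ x, f x = Sum.elim x (0 : Fin q → k) ∘ e.symm := by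
  let L : (Fin m → k) →ₗ[k] (Fin m ⊕ Fin q → k) :=
    { toFun := fun x ↦ Sum.elim x 0
      map_add' := fun x y ↦ by
        ext i; rcases i with i | i <;> simp
      map_smul' := fun c x ↦ by
        ext i; rcases i with i | i <;> simp }
  refine ⟨LinearMap.funLeft k k e.symm ∘ₗ L, fun x y hxy ↦ ?_, fun x ↦ rfl⟩
  funext j
  have h := congrFun hxy (e (Sum.inl j))
  simpa [L] using h

/-- **The first block acts on `(x, 0)`**: if `M = e·(A B; 0 D)·e⁻¹` then
`M·((x, 0)∘e⁻¹) = (A·x, 0)∘e⁻¹`. [folklore] -/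
theorem reindex_fromBlocks_mulVec_inl {k : Type*} [CommRing k] {m q n : ℕ}
    (e : Fin m ⊕ Fin q ≃ Fin n) (A : Matrix (Fin m) (Fin m) k) (B : Matrix (Fin m) (Fin q) k)
    (D : Matrix (Fin q) (Fin q) k) (x : Fin m → k) :
    Matrix.reindex e e (Matrix.fromBlocks A B 0 D) *ᵥ (Sum.elim x (0 : Fin q → k) ∘ e.symm) =
      Sum.elim (A *ᵥ x) (0 : Fin q → k) ∘ e.symm := by
  rw [Matrix.reindex_apply, Matrix.submatrix_mulVec_equiv]
  congr 1
  rw [Function.comp_assoc, Equiv.symm_symm, Equiv.symm_comp_self, Function.comp_id,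
    Matrix.fromBlocks_mulVec, Sum.elim_comp_inl, Sum.elim_comp_inr, Matrix.mulVec_zero,
    Matrix.mulVec_zero, add_zero, add_zero, Matrix.zero_mulVec]

/-- **`ρ(σ₁) ρ ρ(σ₁)⁻¹ ↪ (Ind_{Γ_F}^{Γ_K} ρ)|_{Γ_F}` in coordinates** (the unit of Frobenius
reciprocity; Mackey at the trivial double coset, no normality): for an arbitrary finite extension of
number fields `F/K` with `[F : K] = d` and a framed `ρ : Γ_F →ₜ* GL_n(A)` there are `σ₁ ∈ Γ_F`
(`res σ₁ = r_{i₀}⁻¹`, `i₀` the trivial coset) and an injective linear `f : Aⁿ → A^{dn}` with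
`Ind(ρ)(res σ)·f(x) = f((ρ(σ₁) ρ(σ) ρ(σ₁)⁻¹)·x)` for all `σ ∈ Γ_F`, `x ∈ Aⁿ`.  The block column
of `i₀` in `Ind(ρ)(res σ) = (ρ̇(rᵢ⁻¹ res(σ) rⱼ))ᵢⱼ` vanishes off the diagonal (`rᵢ⁻¹ res(σ) r_{i₀} ∈
res(Γ_F)` forces `rᵢ ∈ res(Γ_F)`), and the diagonal block is `ρ̇(r_{i₀}⁻¹ res(σ) r_{i₀}) =
ρ(σ₁ σ σ₁⁻¹)`; `f` = the coordinates of block `i₀` moved first (`exists_blockSplitEquiv`).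
[cite: SerreLinearRepresentations1977, §7.3 Prop. 22] [cite: SerreAbelianLadic1968, Ch. I §2.1] -/
theorem exists_embedding_induce_restrictField (K F : Type) [Field K] [NumberField K] [Field F]
    [NumberField F] [Algebra K F] {d : ℕ} (hd : Module.finrank K F = d)
    {A : Type*} [CommRing A] [TopologicalSpace A] [IsTopologicalRing A] {n : ℕ}
    (ρ : FramedGaloisRep F A n) :
    ∃ (σ₁ : absoluteGaloisGroup F) (f : (Fin n → A) →ₗ[A] (Fin (d * n) → A)),
      Function.Injective f ∧
      ∀ (σ : absoluteGaloisGroup F) (x : Fin n → A),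
        (((ρ.induce K hd).restrictField F σ : GL (Fin (d * n)) A) :
            Matrix (Fin (d * n)) (Fin (d * n)) A) *ᵥ f x =
          f (((FramedRep.conj (ρ σ₁) ρ σ : GL (Fin n) A) : Matrix (Fin n) (Fin n) A) *ᵥ x) := by
  -- adapted from Literature/NumberTheory/PAdicHodge/DeRhamInducedRepresentationProofs.lean
  -- (`exists_induce_restrictField_eq_reindex_fromBlocks` and its `indMatrix` lemmas)
  -- the index `i₀` of the trivial coset and `σ₁` with `res σ₁ = r_{i₀}⁻¹`
  have hrinj := (absGaloisCosetRep_bijective K F hd).1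
  obtain ⟨i₀, hi₀⟩ := (absGaloisCosetRep_bijective K F hd).2
    ((1 : absoluteGaloisGroup K) : absoluteGaloisGroup K ⧸ (absGaloisRestrict K F).range)
  have hri₀ : absGaloisCosetRep K F hd i₀ ∈ (absGaloisRestrict K F).range := by
    have h := QuotientGroup.eq.1 hi₀
    rwa [mul_one, inv_mem_iff] at h
  obtain ⟨σ₁, hσ₁⟩ : (absGaloisCosetRep K F hd i₀)⁻¹ ∈ (absGaloisRestrict K F).range :=
    inv_mem hri₀
  -- Mackey at the trivial coset: a representative lies in `res(Γ_F)` iff it is `r_{i₀}`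
  have hmem : ∀ i : Fin d, absGaloisCosetRep K F hd i ∈ (absGaloisRestrict K F).range → i = i₀ := by
    intro i hi
    refine hrinj ?_
    change (absGaloisCosetRep K F hd i : absoluteGaloisGroup K ⧸ (absGaloisRestrict K F).range) =
      (absGaloisCosetRep K F hd i₀ : absoluteGaloisGroup K ⧸ (absGaloisRestrict K F).range)
    rw [QuotientGroup.eq]
    exact Subgroup.mul_mem _ (Subgroup.inv_mem _ hi) hri₀
  -- block column `i₀` vanishes off the diagonal
  have hcol : ∀ (σ : absoluteGaloisGroup F) {i : Fin d}, i ≠ i₀ →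
      indMatrix (absGaloisRestrict K F).toMonoidHom (FramedRep.toMatrixHom ρ)
        (absGaloisCosetRep K F hd) ((absGaloisRestrict K F).toMonoidHom σ) i i₀ = 0 := by
    intro σ i hi
    rw [indMatrix_apply]
    refine dotExtend_of_not_mem _ _ fun hm => hi (hmem i ?_)
    rw [mul_assoc, Subgroup.mul_mem_cancel_right _
      (Subgroup.mul_mem _ (MonoidHom.mem_range.2 ⟨σ, rfl⟩) hri₀), inv_mem_iff] at hm
    exact hm
  -- the diagonal block `i₀` is `ρ(σ₁ σ σ₁⁻¹)`
  have hdiag : ∀ σ : absoluteGaloisGroup F,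
      indMatrix (absGaloisRestrict K F).toMonoidHom (FramedRep.toMatrixHom ρ)
        (absGaloisCosetRep K F hd) ((absGaloisRestrict K F).toMonoidHom σ) i₀ i₀ =
        FramedRep.toMatrixHom ρ (σ₁ * σ * σ₁⁻¹) := by
    intro σ
    have hconj : (absGaloisCosetRep K F hd i₀)⁻¹ * (absGaloisRestrict K F).toMonoidHom σ *
        absGaloisCosetRep K F hd i₀ = (absGaloisRestrict K F).toMonoidHom (σ₁ * σ * σ₁⁻¹) := by
      rw [map_mul, map_mul, map_inv, hσ₁, inv_inv]
    rw [indMatrix_apply, hconj, dotExtend_apply_map (absGaloisRestrict_injective K F)]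
  -- the relabelling moving block `i₀` first
  let q : ℕ := Fintype.card ({i : Fin d // i ≠ i₀} × Fin n)
  let e' : ({i : Fin d // i ≠ i₀} × Fin n) ≃ Fin q := Fintype.equivFin _
  obtain ⟨E₁, hE₁l, hE₁r⟩ := exists_blockSplitEquiv i₀ (Fin n)
  let E₀ : Fin n ⊕ Fin q ≃ Fin d × Fin n := (Equiv.sumCongr (Equiv.refl (Fin n)) e'.symm).trans E₁
  let E : Fin n ⊕ Fin q ≃ Fin (d * n) := E₀.trans finProdFinEquiv
  -- the entries of `Ind(ρ)(res σ)` in the relabelling `E`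
  have hentry : ∀ (σ : absoluteGaloisGroup F) (x y : Fin n ⊕ Fin q),
      (((ρ.induce K hd).restrictField F σ : GL (Fin (d * n)) A) :
          Matrix (Fin (d * n)) (Fin (d * n)) A) (E x) (E y) =
        indMatrix (absGaloisRestrict K F).toMonoidHom (FramedRep.toMatrixHom ρ)
          (absGaloisCosetRep K F hd) ((absGaloisRestrict K F).toMonoidHom σ)
          (E₀ x).1 (E₀ y).1 (E₀ x).2 (E₀ y).2 := by
    intro σ x y
    rw [FramedGaloisRep.restrictField_apply, FramedGaloisRep.induce_apply_coe_apply,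
      indMatrix_apply]
    simp only [E, Equiv.trans_apply, Equiv.symm_apply_apply]
    rfl
  have hl : ∀ a : Fin n, E₀ (Sum.inl a) = (i₀, a) := fun a => by simp [E₀, hE₁l]
  have hr2 : ∀ c : Fin q, (E₀ (Sum.inr c)).1 ≠ i₀ := fun c => by
    simpa [E₀, hE₁r] using (e'.symm c).1.2
  -- the lower-left block vanishes, the upper-left block is the conjugate `ρ(σ₁) ρ ρ(σ₁)⁻¹`
  have h21 : ∀ σ : absoluteGaloisGroup F, Matrix.toBlocks₂₁
      ((((ρ.induce K hd).restrictField F σ : GL (Fin (d * n)) A) :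
        Matrix (Fin (d * n)) (Fin (d * n)) A).submatrix E E) = 0 := by
    intro σ
    ext c b
    simp only [Matrix.toBlocks₂₁, Matrix.of_apply, Matrix.submatrix_apply, Matrix.zero_apply]
    rw [hentry, hl b]
    dsimp only
    rw [hcol σ (hr2 c), Matrix.zero_apply]
  have h11 : ∀ σ : absoluteGaloisGroup F, Matrix.toBlocks₁₁
      ((((ρ.induce K hd).restrictField F σ : GL (Fin (d * n)) A) :
        Matrix (Fin (d * n)) (Fin (d * n)) A).submatrix E E) =
        ((FramedRep.conj (ρ σ₁) ρ σ : GL (Fin n) A) : Matrix (Fin n) (Fin n) A) := by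
    intro σ
    ext a b
    simp only [Matrix.toBlocks₁₁, Matrix.of_apply, Matrix.submatrix_apply]
    rw [hentry, hl a, hl b]
    dsimp only
    rw [hdiag σ, FramedRep.toMatrixHom_apply, FramedRep.conj_apply, map_mul, map_mul, map_inv]
  -- block form of the whole matrix
  have hM : ∀ σ : absoluteGaloisGroup F,
      (((ρ.induce K hd).restrictField F σ : GL (Fin (d * n)) A) :
          Matrix (Fin (d * n)) (Fin (d * n)) A) =
        Matrix.reindex E E (Matrix.fromBlocks
          ((FramedRep.conj (ρ σ₁) ρ σ : GL (Fin n) A) : Matrix (Fin n) (Fin n) A)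
          (Matrix.toBlocks₁₂ ((((ρ.induce K hd).restrictField F σ : GL (Fin (d * n)) A) :
            Matrix (Fin (d * n)) (Fin (d * n)) A).submatrix E E)) 0
          (Matrix.toBlocks₂₂ ((((ρ.induce K hd).restrictField F σ : GL (Fin (d * n)) A) :
            Matrix (Fin (d * n)) (Fin (d * n)) A).submatrix E E))) := by
    intro σ
    have h := Matrix.fromBlocks_toBlocks
      ((((ρ.induce K hd).restrictField F σ : GL (Fin (d * n)) A) :
        Matrix (Fin (d * n)) (Fin (d * n)) A).submatrix E E)
    rw [h21 σ, h11 σ] at h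
    rw [h, Matrix.reindex_apply, Matrix.submatrix_submatrix, Equiv.self_comp_symm,
      Matrix.submatrix_id_id]
  -- the embedding
  obtain ⟨f, hf, hfapply⟩ := exists_blockInl (k := A) E
  refine ⟨σ₁, f, hf, fun σ x ↦ ?_⟩
  rw [hM σ, hfapply, hfapply, reindex_fromBlocks_mulVec_inl]

end Summit.Langlands.Langlands.Theorems.WeilRestrictionConstituentProof

end
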